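import Mathlib.Algebra.Category.ModuleCat.Basic
import Mathlib.Algebra.Homology.HomologicalComplex
import Mathlib.LinearAlgebra.ExteriorAlgebra.Grading
import Mathlib.LinearAlgebra.ExteriorPower.Basic
import Literature.AlgebraicGeometry.Crystalline.KaehlerExteriorDerivative
import HarnessLib

/-!
# The algebraic de Rham complex `Ω•_{B/A} = (⋀ⁿ_B Ω[B⁄A], d)` of a ring map

For a commutative ring `A` and a commutative `A`-algebra `B`, the exterior derivative
`d = KaehlerExteriorDerivative.extD A B` on `E = ⋀_B Ω[B⁄A]` (constructed in
`Crystalline/KaehlerExteriorDerivative`) raises the degree by one; this file packages its graded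
pieces:

* `extD_mem_exteriorPower_succ`: `x ∈ ⋀ⁿ Ω[B⁄A] → d x ∈ ⋀ⁿ⁺¹ Ω[B⁄A]`;
* `kaehlerExteriorDerivative A B n : ⋀[B]^n Ω[B⁄A] →ₗ[A] ⋀[B]^(n+1) Ω[B⁄A]`, **the exterior
  derivative on `n`-forms**, with `d ∘ d = 0` (`kaehlerExteriorDerivative_comp`), the degree-`0`
  identification `d = D` (`kaehlerExteriorDerivative_zeroEquiv_symm`), the value on the standard
  generators `d (b • (dt₁ ∧ ⋯ ∧ dtₙ)) = db ∧ dt₁ ∧ ⋯ ∧ dtₙ` (`extD_smul_ιMulti_D`,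
  `kaehlerExteriorDerivative_smul_ιMulti_D`) and the signed Leibniz rule on `p`-forms
  (`extD_mul_of_mem`);
* `deRhamComplex A B : CochainComplex (ModuleCat A) ℕ`, **the algebraic de Rham complex of `B/A`**
  (`X n = ⋀ⁿ_B Ω[B⁄A]`, `d = kaehlerExteriorDerivative`).

Sources: EGA IV₄ (Publ. IHÉS 32, 1967) §16.6; The Stacks project, Tag 0FKF (de Rham complex of a
ring map); R. Hartshorne, *Algebraic Geometry* (1977), III.7 p. 225; A. Grothendieck, *On the de Rham
cohomology of algebraic varieties*, Publ. IHÉS 29 (1966). [folklore]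
Everything is proved; no named facts. Naturality in `B` is in the sequel
`Crystalline/KaehlerDeRhamComplexNaturality`. NOT here: de Rham cohomology groups, the comparison
with `Motives/AffineAlgebraicDeRham`, base change, sheafification (`Motives/HodgeSheaves`).
-/

noncomputable section

namespace Literature.AlgebraicGeometry.Crystalline

open KaehlerDifferential (D)
open ExteriorAlgebra (ι)

universe u v

/-! ### Two small exterior-algebra facts -/

section ExteriorAlgebra

variable {R : Type u} [CommRing R] {M : Type v} [AddCommGroup M] [Module R M]

/-- `ι m ∈ ⋀¹ M`. [folklore] -/
theorem ι_mem_exteriorPower_one (m : M) : ι R m ∈ ⋀[R]^1 M := by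
  rw [← exteriorPower.ιMulti_span_fixedDegree]
  refine Submodule.subset_span ⟨fun _ ↦ m, ?_⟩
  rw [ExteriorAlgebra.ιMulti_succ_apply, ExteriorAlgebra.ιMulti_zero_apply, mul_one]

/-- The grading involution is `(-1)ᵖ` on `p`-vectors: `x̄ = (-1)ᵖ • x` for `x ∈ ⋀ᵖ M`.
[folklore] -/
theorem involute_eq_smul_of_mem {p : ℕ} {x : ExteriorAlgebra R M} (hx : x ∈ ⋀[R]^p M) :
    CliffordAlgebra.involute x = (-1 : R) ^ p • x := by
  induction hx using Submodule.pow_induction_on_left' with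
  | algebraMap r => rw [AlgHom.commutes, pow_zero, one_smul]
  | add x y i _ _ hx hy => rw [map_add, hx, hy, smul_add]
  | mem_mul m hm i x _ hx =>
    obtain ⟨w, rfl⟩ := hm
    rw [map_mul, hx, CliffordAlgebra.involute_ι, pow_succ, mul_smul_comm, mul_comm, mul_smul,
      neg_one_smul, neg_mul, smul_neg]

/-- Left multiplication by a one-vector, `⋀ⁿ M → ⋀ⁿ⁺¹ M`, `x ↦ ι m ∧ x`. [folklore] -/
def ιMul (n : ℕ) (m : M) : ⋀[R]^n M →ₗ[R] ⋀[R]^(n + 1) M where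
  toFun x := ⟨ι R m * x, by
    simpa only [add_comm n 1] using SetLike.mul_mem_graded (ι_mem_exteriorPower_one m) x.2⟩
  map_add' x y := Subtype.ext (mul_add _ _ _)
  map_smul' r x := Subtype.ext (mul_smul_comm r (ι R m) (x : ExteriorAlgebra R M))

/-- `ιMul n m x = ι m * x` in the exterior algebra. [folklore] -/
@[simp] theorem coe_ιMul (n : ℕ) (m : M) (x : ⋀[R]^n M) :
    (ιMul n m x : ExteriorAlgebra R M) = ι R m * x := rfl

/-- `m₀ ∧ (m₁ ∧ ⋯ ∧ mₙ) = m₀ ∧ m₁ ∧ ⋯ ∧ mₙ`: `ιMul` on the standard generators. [folklore] -/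
theorem ιMul_ιMulti (n : ℕ) (m : M) (v : Fin n → M) :
    ιMul n m (exteriorPower.ιMulti R n v) = exteriorPower.ιMulti R (n + 1) (Fin.cons m v) := by
  apply Subtype.ext
  rw [coe_ιMul, exteriorPower.ιMulti_apply_coe, exteriorPower.ιMulti_apply_coe,
    ExteriorAlgebra.ιMulti_succ_apply]
  rfl

end ExteriorAlgebra

variable (A : Type u) (B : Type v) [CommRing A] [CommRing B] [Algebra A B]

namespace KaehlerExteriorDerivative

/-! ### The exterior derivative raises the degree by one -/

/-- `d ω ∈ ⋀² Ω[B⁄A]` for a one-form `ω`. [folklore] -/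
theorem extD_ι_mem (ω : Ω[B⁄A]) : extD A B (ι B ω) ∈ ⋀[B]^2 (Ω[B⁄A]) := by
  have hω : ω ∈ Submodule.span B (Set.range (D A B)) := by
    rw [KaehlerDifferential.span_range_derivation]; trivial
  induction hω using Submodule.span_induction with
  | mem x hx => obtain ⟨t, rfl⟩ := hx; rw [extD_ι_D]; exact zero_mem _
  | zero => rw [map_zero, map_zero]; exact zero_mem _
  | add x y _ _ hx hy => rw [map_add, map_add]; exact add_mem hx hy
  | smul b x _ hx =>
    rw [extD_ι_smul]
    exact add_mem (SetLike.mul_mem_graded (ι_mem_exteriorPower_one (D A B b))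
      (ι_mem_exteriorPower_one x)) (Submodule.smul_mem _ b hx)

/-- **The exterior derivative has degree `+1`**: `x ∈ ⋀ⁿ Ω[B⁄A] → d x ∈ ⋀ⁿ⁺¹ Ω[B⁄A]`.
[folklore] -/
theorem extD_mem_exteriorPower_succ {n : ℕ} {x : ExteriorAlgebra B (Ω[B⁄A])}
    (hx : x ∈ ⋀[B]^n (Ω[B⁄A])) : extD A B x ∈ ⋀[B]^(n + 1) (Ω[B⁄A]) := by
  induction hx using Submodule.pow_induction_on_left' with
  | algebraMap b =>
    rw [extD_algebraMap]
    exact ι_mem_exteriorPower_one (D A B b)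
  | add x y i _ _ hx hy => rw [map_add]; exact add_mem hx hy
  | mem_mul m hm i x hx ih =>
    obtain ⟨ω, rfl⟩ := hm
    rw [extD_mul, CliffordAlgebra.involute_ι, neg_mul]
    refine add_mem ?_ (neg_mem ?_)
    · simpa only [show 2 + i = i.succ + 1 by omega] using SetLike.mul_mem_graded (extD_ι_mem A B ω) hx
    · simpa only [show 1 + (i + 1) = i.succ + 1 by omega] using
        SetLike.mul_mem_graded (ι_mem_exteriorPower_one ω) ih

/-- **The exterior derivative on `n`-forms**, `d : ⋀ⁿ_B Ω[B⁄A] → ⋀ⁿ⁺¹_B Ω[B⁄A]`, an `A`-linear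
map: the restriction of `extD` to the graded pieces of the exterior algebra. It satisfies
`d ∘ d = 0` (`kaehlerExteriorDerivative_comp`), agrees with the universal derivation `D` in degree
`0` (`kaehlerExteriorDerivative_zeroEquiv_symm`), and `d (b • (dt₁ ∧ ⋯ ∧ dtₙ)) = db ∧ dt₁ ∧ ⋯ ∧ dtₙ`
(`kaehlerExteriorDerivative_smul_ιMulti_D`).
(EGA IV₄ 16.6; Stacks 0FKF; Hartshorne III.7.) [folklore] -/
def kaehlerExteriorDerivative (n : ℕ) : ⋀[B]^n (Ω[B⁄A]) →ₗ[A] ⋀[B]^(n + 1) (Ω[B⁄A]) where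
  toFun x := ⟨extD A B x, extD_mem_exteriorPower_succ A B x.2⟩
  map_add' x y := Subtype.ext (map_add (extD A B) (x : ExteriorAlgebra B (Ω[B⁄A])) y)
  map_smul' a x := by
    apply Subtype.ext
    change extD A B ((a • x : ⋀[B]^n (Ω[B⁄A])) : ExteriorAlgebra B (Ω[B⁄A])) = a • extD A B x
    rw [Submodule.coe_smul_of_tower, map_smul]

/-- The exterior derivative on `n`-forms is `extD` on underlying elements. [folklore] -/
@[simp] theorem coe_kaehlerExteriorDerivative (n : ℕ) (x : ⋀[B]^n (Ω[B⁄A])) :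
    (kaehlerExteriorDerivative A B n x : ExteriorAlgebra B (Ω[B⁄A])) = extD A B x := rfl

/-- **`d ∘ d = 0`** on `n`-forms. [folklore] -/
theorem kaehlerExteriorDerivative_kaehlerExteriorDerivative (n : ℕ) (x : ⋀[B]^n (Ω[B⁄A])) :
    kaehlerExteriorDerivative A B (n + 1) (kaehlerExteriorDerivative A B n x) = 0 :=
  Subtype.ext (extD_extD A B x)

/-- **`d ∘ d = 0`** as a composition of linear maps. [folklore] -/
theorem kaehlerExteriorDerivative_comp (n : ℕ) :
    kaehlerExteriorDerivative A B (n + 1) ∘ₗ kaehlerExteriorDerivative A B n = 0 :=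
  LinearMap.ext (kaehlerExteriorDerivative_kaehlerExteriorDerivative A B n)

/-- Leibniz rule for functions on `n`-forms: `d (b • x) = D b ∧ x + b • d x`. [folklore] -/
theorem kaehlerExteriorDerivative_smul (n : ℕ) (b : B) (x : ⋀[B]^n (Ω[B⁄A])) :
    kaehlerExteriorDerivative A B n (b • x) =
      ιMul n (D A B b) x + b • kaehlerExteriorDerivative A B n x :=
  Subtype.ext (by
    rw [coe_kaehlerExteriorDerivative, Submodule.coe_smul, extD_smul, Submodule.coe_add, coe_ιMul,
      Submodule.coe_smul, coe_kaehlerExteriorDerivative])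

/-! ### Values on generators, degree zero, signed Leibniz rule -/

/-- `d (dt₁ ∧ ⋯ ∧ dtₙ) = 0`. [folklore] -/
theorem extD_ιMulti_D (n : ℕ) (t : Fin n → B) :
    extD A B (ExteriorAlgebra.ιMulti B n (D A B ∘ t)) = 0 := by
  induction n with
  | zero =>
    rw [ExteriorAlgebra.ιMulti_zero_apply, ← (algebraMap B (ExteriorAlgebra B (Ω[B⁄A]))).map_one,
      extD_algebraMap, Derivation.map_one_eq_zero, map_zero]
  | succ n ih =>
    rw [ExteriorAlgebra.ιMulti_succ_apply, extD_mul, CliffordAlgebra.involute_ι, neg_mul]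
    change extD A B (ι B (D A B (t 0))) * _ + -(_ * extD A B (ExteriorAlgebra.ιMulti B n
      (D A B ∘ Matrix.vecTail t))) = 0
    rw [extD_ι_D, zero_mul, zero_add, ih, mul_zero, neg_zero]

/-- **`d (b • (dt₁ ∧ ⋯ ∧ dtₙ)) = db ∧ dt₁ ∧ ⋯ ∧ dtₙ`** (the classical defining formula, Stacks
0FKF), in the exterior algebra. [folklore] -/
theorem extD_smul_ιMulti_D (n : ℕ) (b : B) (t : Fin n → B) :
    extD A B (b • ExteriorAlgebra.ιMulti B n (D A B ∘ t)) =
      ExteriorAlgebra.ιMulti B (n + 1) (D A B ∘ Fin.cons b t) := by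
  rw [extD_smul, extD_ιMulti_D, smul_zero, add_zero, ExteriorAlgebra.ιMulti_succ_apply]
  rfl

/-- `d (b • (dt₁ ∧ ⋯ ∧ dtₙ)) = db ∧ dt₁ ∧ ⋯ ∧ dtₙ` for the exterior derivative on `n`-forms.
[folklore] -/
theorem kaehlerExteriorDerivative_smul_ιMulti_D (n : ℕ) (b : B) (t : Fin n → B) :
    kaehlerExteriorDerivative A B n (b • exteriorPower.ιMulti B n (D A B ∘ t)) =
      exteriorPower.ιMulti B (n + 1) (D A B ∘ Fin.cons b t) :=
  Subtype.ext (by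
    rw [coe_kaehlerExteriorDerivative, Submodule.coe_smul, exteriorPower.ιMulti_apply_coe,
      exteriorPower.ιMulti_apply_coe, extD_smul_ιMulti_D])

/-- `d (dt₁ ∧ ⋯ ∧ dtₙ) = 0` for the exterior derivative on `n`-forms. [folklore] -/
theorem kaehlerExteriorDerivative_ιMulti_D (n : ℕ) (t : Fin n → B) :
    kaehlerExteriorDerivative A B n (exteriorPower.ιMulti B n (D A B ∘ t)) = 0 :=
  Subtype.ext (by rw [coe_kaehlerExteriorDerivative, exteriorPower.ιMulti_apply_coe, extD_ιMulti_D,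
    Submodule.coe_zero])

/-- **In degree `0` the exterior derivative is the universal derivation**: under `⋀⁰ ≅ B` and
`⋀¹ ≅ Ω[B⁄A]` (Mathlib's `exteriorPower.zeroEquiv`, `exteriorPower.oneEquiv`), `d b = D b`.
[folklore] -/
theorem kaehlerExteriorDerivative_zeroEquiv_symm (b : B) :
    kaehlerExteriorDerivative A B 0 ((exteriorPower.zeroEquiv B (Ω[B⁄A])).symm b) =
      (exteriorPower.oneEquiv B (Ω[B⁄A])).symm (D A B b) := by
  apply Subtype.ext
  rw [coe_kaehlerExteriorDerivative, exteriorPower.zeroEquiv_symm_apply,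
    exteriorPower.oneEquiv_symm_apply, Submodule.coe_smul, exteriorPower.ιMulti_apply_coe,
    exteriorPower.ιMulti_apply_coe, ExteriorAlgebra.ιMulti_zero_apply,
    ExteriorAlgebra.ιMulti_succ_apply, ExteriorAlgebra.ιMulti_zero_apply, mul_one,
    Algebra.smul_def, mul_one, extD_algebraMap]

/-- In degree `0`: `d x = D (x)` read through `⋀⁰ ≅ B`, `⋀¹ ≅ Ω[B⁄A]`. [folklore] -/
theorem oneEquiv_kaehlerExteriorDerivative_zero (x : ⋀[B]^0 (Ω[B⁄A])) :
    exteriorPower.oneEquiv B (Ω[B⁄A]) (kaehlerExteriorDerivative A B 0 x) =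
      D A B (exteriorPower.zeroEquiv B (Ω[B⁄A]) x) := by
  obtain ⟨b, rfl⟩ := (exteriorPower.zeroEquiv B (Ω[B⁄A])).symm.surjective x
  rw [kaehlerExteriorDerivative_zeroEquiv_symm, LinearEquiv.apply_symm_apply,
    LinearEquiv.apply_symm_apply]

/-- **Signed Leibniz rule**: for a `p`-form `x` and any form `y`,
`d (x ∧ y) = d x ∧ y + (-1)ᵖ x ∧ d y`. [folklore] -/
theorem extD_mul_of_mem {p : ℕ} {x : ExteriorAlgebra B (Ω[B⁄A])} (hx : x ∈ ⋀[B]^p (Ω[B⁄A]))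
    (y : ExteriorAlgebra B (Ω[B⁄A])) :
    extD A B (x * y) = extD A B x * y + (-1 : B) ^ p • (x * extD A B y) := by
  rw [extD_mul, involute_eq_smul_of_mem hx, smul_mul_assoc]

/-! ### The algebraic de Rham complex -/

/-- **The algebraic de Rham complex `Ω•_{B/A}`** of the `A`-algebra `B`: the cochain complex of
`A`-modules `B = ⋀⁰ Ω[B⁄A] →ᵈ Ω[B⁄A] = ⋀¹ Ω[B⁄A] →ᵈ ⋀² Ω[B⁄A] →ᵈ ⋯` with `Xⁿ = ⋀ⁿ_B Ω[B⁄A]` and the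
exterior derivative as differential (Mathlib's `CochainComplex.of`).
(Grothendieck 1966; EGA IV₄ 16.6; Stacks 0FKF; Hartshorne III.7 p. 225.) [folklore] -/
def deRhamComplex : CochainComplex (ModuleCat.{v} A) ℕ :=
  CochainComplex.of (fun n ↦ ModuleCat.of A (⋀[B]^n (Ω[B⁄A])))
    (fun n ↦ ModuleCat.ofHom (kaehlerExteriorDerivative A B n))
    (fun n ↦ by
      rw [← ModuleCat.ofHom_comp, kaehlerExteriorDerivative_comp]
      rfl)

/-- The `n`-th term of the de Rham complex is `⋀ⁿ_B Ω[B⁄A]`. [folklore] -/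
theorem deRhamComplex_X (n : ℕ) :
    (deRhamComplex A B).X n = ModuleCat.of A (⋀[B]^n (Ω[B⁄A])) := rfl

/-- The differential of the de Rham complex is the exterior derivative. [folklore] -/
theorem deRhamComplex_d (n : ℕ) :
    (deRhamComplex A B).d n (n + 1) = ModuleCat.ofHom (kaehlerExteriorDerivative A B n) :=
  CochainComplex.of_d _ (fun n ↦ ModuleCat.ofHom (kaehlerExteriorDerivative A B n)) n

/-- The differential of the de Rham complex on elements. [folklore] -/
theorem deRhamComplex_d_apply (n : ℕ) (x : ⋀[B]^n (Ω[B⁄A])) :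
    (deRhamComplex A B).d n (n + 1) x = kaehlerExteriorDerivative A B n x := by
  rw [deRhamComplex_d]
  rfl

end KaehlerExteriorDerivative

end Literature.AlgebraicGeometry.Crystalline

end
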